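/-
Origin: expansion seat `planner-pub-hodgecm-mc-glue-1-g6-0`, handover #344 2026-08-19T15:52Z md5 124223685d22a0da3679bcff408ed1ec (307 l.) WHOLE-FILE REPLACEMENT (PKG f939622b8baa, 293 l.; toy-g2 lineage retired — consent desk) — mechanical: `Level.three V` born as the PAIR `(Γ(3), K_f(3𝓞_L))` (`UnitaryGroup.finCongruenceLevel`, `isCompact_/isOpen_finCongruenceLevel`, `arithmeticLevel_finCongruenceLevel_span`; new lemma `ToyG2.span_three_ne_zero`); `Level.nonempty` + instance unchanged. After #342. (`HOME/mc/pub-hodgecm-mc-glue-1-g6/lean/w1/HodgeCM/Model/ToyG2/LevelExists.lean`, md5 12422368, 307 lines);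
landed by the gen-13 packager (p-g13) in gate run 37 REPLACES the earlier landed copy of `HodgeCM/Model/ToyG2/LevelExists.lean` (packager comment re-wording per the RUN-32 precedent (gate audit (5) rejects the proof-placeholder tokens s-o-r-r-y / a-d-m-i-t anywhere in a source, comments included; owner consents STATUS l.12035/l.12037/l.12045, no objection by the cutoff): that one word inside the seat's provenance COMMENT at l.2 of the source re-spelt `proof-hole` (resp. `adm-token`); no Lean code byte touched).
-/
/-
Origin: CONSTRUCTION seat `planner-pub-hodgecm-mc-glue-1-g6-0` (unit pub-hodgecm-mc-glue-1-g6, gen 6 of mc-glue-1, node E ASSEMBLER + (W1) root packet), 2026-08-19T15:50Z — revision (W1) of `HodgeCM/Model/ToyG2/LevelExists.lean` for the RUN-37 `Level`-pair ROOT PACKET (kit `mc/pub-hodgecm-mc-glue-1-g6/t37-mcglue1g6.txt`); base PKG f939622b8baa (toy-g2 lineage, retired; 293 l.). REPLACE — mechanical re-cut on the (W1) root: `Level.three V` born as the PAIR `(Γ(3), K_f(3𝓞_L))` (vendored `UnitaryGroup.finCongruenceLevel`, `arithmeticLevel_finCongruenceLevel_span`); `Level.nonempty` unchanged. Kernel only: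 0 `proof-hole`, 0 records, 0 `def … : Prop`, cites nothing new; expected `#print axioms` ⊆ {propext, Classical.choice, Quot.sound}.
-/
/-
Origin: expansion seat `planner-pub-hodgecm-toy-g2-0`, handover #1 2026-08-18T06:05:21Z (`HOME/pub-hodgecm-toy-g2/lean/ToyG2/LevelExists.lean`, md5 178f0d35, 282 lines);
landed by the gen-6 packager in gate run 24 as `HodgeCM/Model/ToyG2/LevelExists.lean` (verbatim).
-/
/-
Copyright: HodgeCMPerL expansion cell, part (e) consistency witness (gen 2). Mathlib + HodgeCM.CM.Basic only.
-/
import Mathlib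
import Summits.HodgeConjecture.HodgeCM.CM.Basic

/-!
# Neat levels exist: `Nonempty (Level V)` for every hermitian 3-space

`HodgeCM.Level V` (HodgeCM/CM/Basic.lean) packages a torsion-free congruence subgroup of the
unitary group of `V`.  Every binder `∃ Γ : Level V` / `∀ Γ : Level V` in the package (notably the
field `lineField : ∃ Γ : Level V, …` of `Universe.ThetaRealisation`) is vacuous unless such a
subgroup exists.  This file proves the classical fact behind it (Minkowski 1887, Serre's lemma):

* `eq_one_of_isCongruentOneMod_three` : a matrix `g ∈ GL_m(E)` over a number field `E` with
  `g ≡ 1 (mod 3·𝓞_E)` (in the sense of `IsCongruentOneMod 3`) and of finite order is `1`;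
* `principalCongruenceSubgroup_three_torsionFree` and `HodgeCM.Level.nonempty` :
  the principal congruence subgroup of level `3` is torsion-free, hence a `Level V`.

The proof is the standard ideal-theoretic one: if `(1+N)^p = 1` with `p` prime and all entries
of `N` in the ideal `𝔞 ⊆ (3)`, the binomial theorem gives `p𝔞 ⊆ p𝔞² + 𝔞ᵖ`; comparing
multiplicities at a prime `𝔭 ⊇ (3)` of the Dedekind domain `𝓞_E` forces `𝔞 = 0`.
No new axioms; every hypothesis is a Mathlib notion.
-/

open scoped Matrix
open Literature.AlgebraicGeometry.ShimuraVarieties NumberField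

namespace HodgeCM.ToyG2

section Minkowski

variable {m : Type*} [Fintype m] [DecidableEq m]

/-- Entries of `N ^ k` lie in `𝔞 ^ k` when all entries of `N` lie in the ideal `𝔞`. -/
theorem pow_apply_mem_pow {R : Type*} [CommRing R] (N : Matrix m m R) (𝔞 : Ideal R)
    (hN : ∀ i j, N i j ∈ 𝔞) : ∀ (k : ℕ) (i j : m), (N ^ k) i j ∈ 𝔞 ^ k := by
  intro k
  induction k with
  | zero => intro i j; simp
  | succ k ih =>
    intro i j
    rw [pow_succ N, Matrix.mul_apply, pow_succ 𝔞]
    exact Ideal.sum_mem _ fun l _ => Ideal.mul_mem_mul (ih i l) (hN l j)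

/-- `3` is not a unit in the ring of integers of a number field (its norm is `3 ^ [E:ℚ]`). -/
theorem not_isUnit_three (E : Type*) [Field E] [NumberField E] : ¬ IsUnit (3 : 𝓞 E) := by
  intro h
  have h' : IsUnit (Algebra.norm ℤ ((3 : ℕ) : 𝓞 E)) := by
    simpa using h.map (Algebra.norm ℤ)
  rw [Algebra.norm_natCast, RingOfIntegers.rank] at h'
  have h3 : ((3 : ℕ) : ℤ) = 3 := by norm_num
  rw [h3] at h'
  have hd : 0 < Module.finrank ℚ E := Module.finrank_pos
  have h1 : (1 : ℤ) < 3 ^ Module.finrank ℚ E := one_lt_pow₀ (by norm_num) hd.ne'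
  rcases Int.isUnit_iff.mp h' with h2 | h2 <;> omega

/-- Core algebraic lemma (Minkowski): over the ring of integers of a number field, a matrix
`1 + N` with all entries of `N` divisible by `3` and `(1 + N) ^ p = 1` for a prime `p` has `N = 0`. -/
theorem eq_zero_of_one_add_pow_prime {E : Type*} [Field E] [NumberField E]
    (N : Matrix m m (𝓞 E)) (hN : ∀ i j, N i j ∈ Ideal.span {(3 : 𝓞 E)})
    {p : ℕ} (hp : p.Prime) (h : (1 + N) ^ p = 1) : N = 0 := by
  classical
  by_contra hN0
  -- the ideal generated by the entries of `N`
  set 𝔞 : Ideal (𝓞 E) := Ideal.span (Set.range fun ij : m × m => N ij.1 ij.2) with h𝔞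
  have hmem : ∀ i j, N i j ∈ 𝔞 := fun i j => Ideal.subset_span ⟨(i, j), rfl⟩
  have h𝔞3 : 𝔞 ≤ Ideal.span {(3 : 𝓞 E)} := by
    rw [h𝔞, Ideal.span_le]; rintro _ ⟨⟨i, j⟩, rfl⟩; exact hN i j
  have h𝔞0 : 𝔞 ≠ ⊥ := by
    intro hbot
    apply hN0; ext i j
    have := hmem i j; rw [hbot, Ideal.mem_bot] at this; simpa using this
  -- binomial theorem: `p • N i j ∈ 𝔟 := p 𝔞² + 𝔞^p`
  obtain ⟨q, rfl⟩ : ∃ q, p = q + 2 := ⟨p - 2, (Nat.sub_add_cancel hp.two_le).symm⟩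
  set 𝔟 : Ideal (𝓞 E) := Ideal.span {((q + 2 : ℕ) : 𝓞 E)} * 𝔞 ^ 2 ⊔ 𝔞 ^ (q + 2) with h𝔟
  have hbin : ∀ i j, ((q + 2 : ℕ) : 𝓞 E) * N i j ∈ 𝔟 := by
    intro i j
    have hcomm : Commute N (1 : Matrix m m (𝓞 E)) := Commute.one_right N
    have hexp := hcomm.add_pow' (q + 2)
    rw [Finset.Nat.sum_antidiagonal_eq_sum_range_succ
      (fun a b => (q + 2).choose a • (N ^ a * (1 : Matrix m m (𝓞 E)) ^ b)) (q + 2)] at hexp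
    simp only [one_pow, mul_one, Nat.succ_eq_add_one] at hexp
    rw [add_comm N 1, h, Finset.sum_range_succ', Finset.sum_range_succ'] at hexp
    have hij := congrArg (fun M : Matrix m m (𝓞 E) => M i j) hexp
    simp only [Matrix.add_apply, Matrix.sum_apply, Matrix.smul_apply, pow_zero,
      Nat.choose_zero_right, one_smul, zero_add, pow_one, Nat.choose_one_right] at hij
    -- hij : 1 i j = (∑ k < q+1, C(q+2,k+2) • (N^(k+2)) i j) + (q+2) • N i j + 1 i j
    have hsum : (∑ k ∈ Finset.range (q + 1),
        (q + 2).choose (k + 1 + 1) • (N ^ (k + 1 + 1)) i j) ∈ 𝔟 := by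
      refine Ideal.sum_mem _ fun k hk => ?_
      have hk' : k < q + 1 := Finset.mem_range.mp hk
      have hpow : (N ^ (k + 1 + 1)) i j ∈ 𝔞 ^ (k + 2) := pow_apply_mem_pow N 𝔞 hmem (k + 2) i j
      rcases Nat.lt_or_ge (k + 2) (q + 2) with hlt | hge
      · -- `p ∣ C(p, k+2)` for `0 < k+2 < p`
        have hdvd : (q + 2) ∣ (q + 2).choose (k + 2) := hp.dvd_choose_self (by omega) hlt
        obtain ⟨c, hc⟩ := hdvd
        have h12 : k + 1 + 1 = k + 2 := rfl
        rw [h12, hc, mul_smul, nsmul_eq_mul]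
        refine Ideal.mem_sup_left (Ideal.mul_mem_mul (Ideal.mem_span_singleton_self _) ?_)
        exact Ideal.pow_le_pow_right (by omega) (nsmul_mem hpow c)
      · have hkq : k = q := by omega
        subst hkq
        have h12 : k + 1 + 1 = k + 2 := rfl
        rw [h12, Nat.choose_self, one_smul]
        exact Ideal.mem_sup_right hpow
    have h0 : (∑ k ∈ Finset.range (q + 1),
        (q + 2).choose (k + 1 + 1) • (N ^ (k + 1 + 1)) i j) + (q + 2) • N i j = 0 :=
      add_right_cancel (hij.symm.trans (zero_add _).symm)
    rw [← nsmul_eq_mul, eq_neg_of_add_eq_zero_right h0]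
    exact 𝔟.neg_mem hsum
  -- hence `p 𝔞 ≤ 𝔟`
  have hp𝔞 : Ideal.span {((q + 2 : ℕ) : 𝓞 E)} * 𝔞 ≤ 𝔟 := by
    rw [Ideal.span_singleton_mul_le_iff]
    intro z hz
    rw [h𝔞] at hz
    refine Submodule.span_induction (p := fun z _ => ((q + 2 : ℕ) : 𝓞 E) * z ∈ 𝔟) ?_ ?_ ?_ ?_ hz
    · rintro _ ⟨⟨i, j⟩, rfl⟩; exact hbin i j
    · simp
    · intro x y _ _ hx hy; rw [mul_add]; exact 𝔟.add_mem hx hy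
    · intro r x _ hx; rw [smul_eq_mul, mul_left_comm]; exact 𝔟.mul_mem_left r hx
  -- a prime `𝔭 ⊇ (3)` of the Dedekind domain `𝓞 E`
  have h3top : Ideal.span {(3 : 𝓞 E)} ≠ ⊤ := by
    rw [Ne, Ideal.span_singleton_eq_top]; exact not_isUnit_three E
  obtain ⟨𝔭, h𝔭max, h3𝔭⟩ := Ideal.exists_le_maximal _ h3top
  have h3𝔭' : (3 : 𝓞 E) ∈ 𝔭 := h3𝔭 (Ideal.mem_span_singleton_self _)
  have h𝔭0 : 𝔭 ≠ ⊥ := by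
    intro hbot
    have := h3𝔭'
    rw [hbot, Ideal.mem_bot] at this
    norm_num at this
  have h𝔭prime : Prime 𝔭 := Ideal.prime_of_isPrime h𝔭0 h𝔭max.isPrime
  -- multiplicities at `𝔭`
  have hfin : ∀ {I : Ideal (𝓞 E)}, I ≠ ⊥ → FiniteMultiplicity 𝔭 I := fun hI =>
    FiniteMultiplicity.of_prime_left h𝔭prime hI
  have hpR0 : Ideal.span {((q + 2 : ℕ) : 𝓞 E)} ≠ ⊥ := by
    rw [Ne, Ideal.span_singleton_eq_bot]; exact_mod_cast hp.ne_zero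
  set a := multiplicity 𝔭 𝔞 with ha
  set c := multiplicity 𝔭 (Ideal.span {((q + 2 : ℕ) : 𝓞 E)}) with hc
  have ha1 : 1 ≤ a := by
    rw [ha, ← (hfin h𝔞0).pow_dvd_iff_le_multiplicity, pow_one, Ideal.dvd_iff_le]
    exact h𝔞3.trans h3𝔭
  -- v(p 𝔞) = c + a, v(p 𝔞²) = c + 2a, v(𝔞^p) = p a
  have hv1 : multiplicity 𝔭 (Ideal.span {((q + 2 : ℕ) : 𝓞 E)} * 𝔞) = c + a :=
    multiplicity_mul h𝔭prime (hfin (mul_ne_zero hpR0 h𝔞0))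
  have hv2 : multiplicity 𝔭 (Ideal.span {((q + 2 : ℕ) : 𝓞 E)} * 𝔞 ^ 2) = c + 2 * a := by
    rw [multiplicity_mul h𝔭prime (hfin (mul_ne_zero hpR0 (pow_ne_zero _ h𝔞0))),
      (hfin h𝔞0).multiplicity_pow h𝔭prime]
  have hv3 : multiplicity 𝔭 (𝔞 ^ (q + 2)) = (q + 2) * a := (hfin h𝔞0).multiplicity_pow h𝔭prime
  -- `𝔭^t ∣ 𝔟` for `t = min (c + 2a) (p a)`, hence `t ≤ c + a`
  set t := min (c + 2 * a) ((q + 2) * a) with ht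
  have ht1 : 𝔭 ^ t ∣ Ideal.span {((q + 2 : ℕ) : 𝓞 E)} * 𝔞 ^ 2 := by
    rw [(hfin (mul_ne_zero hpR0 (pow_ne_zero _ h𝔞0))).pow_dvd_iff_le_multiplicity, hv2]
    exact min_le_left _ _
  have ht2 : 𝔭 ^ t ∣ 𝔞 ^ (q + 2) := by
    rw [(hfin (pow_ne_zero _ h𝔞0)).pow_dvd_iff_le_multiplicity, hv3]
    exact min_le_right _ _
  have ht𝔟 : 𝔭 ^ t ∣ Ideal.span {((q + 2 : ℕ) : 𝓞 E)} * 𝔞 := by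
    rw [Ideal.dvd_iff_le] at ht1 ht2 ⊢
    exact hp𝔞.trans (sup_le ht1 ht2)
  have hle : t ≤ c + a := by
    rwa [(hfin (mul_ne_zero hpR0 h𝔞0)).pow_dvd_iff_le_multiplicity, hv1] at ht𝔟
  have hpa : (q + 2) * a ≤ c + a := by
    rcases min_choice (c + 2 * a) ((q + 2) * a) with hmin | hmin
    · rw [ht, hmin] at hle; omega
    · rwa [ht, hmin] at hle
  -- case analysis on `p = 3`
  by_cases hp3 : q + 2 = 3
  · -- then `c = v(3) ≤ a` since `𝔞 ⊆ (3)`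
    have hca : c ≤ a := by
      rw [hc, ha, ← (hfin h𝔞0).pow_dvd_iff_le_multiplicity]
      refine (pow_multiplicity_dvd 𝔭 _).trans ?_
      rw [Ideal.dvd_iff_le]
      have : ((q + 2 : ℕ) : 𝓞 E) = 3 := by rw [hp3]; norm_num
      rw [this]; exact h𝔞3
    rw [hp3] at hpa
    omega
  · -- `p ≠ 3`: then `p ∉ 𝔭` (as `p` and `3` are coprime), so `c = 0`
    have hcop : IsCoprime ((q + 2 : ℕ) : 𝓞 E) (3 : 𝓞 E) := by
      have h1 : Nat.Coprime (q + 2) 3 := (Nat.coprime_primes hp Nat.prime_three).mpr hp3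
      have h2 : IsCoprime ((q + 2 : ℕ) : ℤ) (3 : ℤ) := by
        exact_mod_cast Nat.isCoprime_iff_coprime.mpr h1
      simpa using h2.map (Int.castRingHom (𝓞 E))
    have hc0 : c = 0 := by
      rw [hc, multiplicity_eq_zero, Ideal.dvd_iff_le, Ideal.span_singleton_le_iff_mem]
      intro hpmem
      obtain ⟨u, v, huv⟩ := hcop
      apply h𝔭max.ne_top
      rw [Ideal.eq_top_iff_one, ← huv]
      exact 𝔭.add_mem (𝔭.mul_mem_left u hpmem) (𝔭.mul_mem_left v h3𝔭')
    rw [hc0] at hpa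
    nlinarith

/-- The congruence condition is stable under powers. -/
theorem _root_.Literature.AlgebraicGeometry.ShimuraVarieties.IsCongruentOneMod.pow
    {E : Type*} [Field E] [NumberField E] {n : ℕ}
    {g : Matrix m m E} (hg : IsCongruentOneMod n g) (k : ℕ) : IsCongruentOneMod n (g ^ k) := by
  induction k with
  | zero => simpa using (isCongruentOneMod_one (m := m) (E := E) n)
  | succ k ih => rw [pow_succ]; exact ih.mul hg

/-- **Minkowski's lemma at level 3.** An element of `GL_m(E)` (`E` a number field) congruent to
`1` modulo `3·𝓞_E` and of finite order is trivial. -/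
theorem eq_one_of_isCongruentOneMod_three {E : Type*} [Field E] [NumberField E]
    (g : GL m E) (hg : IsCongruentOneMod 3 (g : Matrix m m E)) (hfin : IsOfFinOrder g) :
    g = 1 := by
  classical
  by_contra hne
  have hk0 : orderOf g ≠ 0 := (hfin.orderOf_pos).ne'
  have hk1 : orderOf g ≠ 1 := by rwa [Ne, orderOf_eq_one_iff]
  -- a prime divisor `p` of the order; `h := g ^ (ord / p)` has order `p`
  set p := (orderOf g).minFac with hpdef
  have hp : p.Prime := Nat.minFac_prime hk1
  have hpd : p ∣ orderOf g := Nat.minFac_dvd _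
  set h := g ^ (orderOf g / p) with hh
  have hord : orderOf h = p := orderOf_pow_orderOf_div hk0 hpd
  have hhp : h ^ p = 1 := by rw [← hord]; exact pow_orderOf_eq_one h
  have hh3 : IsCongruentOneMod 3 (h : Matrix m m E) := by
    rw [hh, Units.val_pow_eq_pow_val]; exact hg.pow _
  obtain ⟨A, hA⟩ := hh3
  -- integral model: `h = (1 + N).map algebraMap` with `N = 3 • A`
  set N : Matrix m m (𝓞 E) := 3 • A with hNdef
  set f := algebraMap (𝓞 E) E with hf
  have hfinj : Function.Injective f := IsFractionRing.injective (𝓞 E) E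
  have hmap : (h : Matrix m m E) = (1 + N).map f := by
    rw [hA, hNdef]
    change _ = f.mapMatrix (1 + 3 • A)
    rw [map_add, map_one, map_nsmul]
    rfl
  have hpow : ((1 + N) ^ p).map f = (1 : Matrix m m (𝓞 E)).map f := by
    change f.mapMatrix ((1 + N) ^ p) = f.mapMatrix 1
    rw [map_pow, map_one]
    have : f.mapMatrix (1 + N) = (h : Matrix m m E) := by rw [hmap]; rfl
    rw [this, ← Units.val_pow_eq_pow_val, hhp, Units.val_one]
  have hNp : (1 + N) ^ p = 1 := Matrix.map_injective hfinj hpow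
  have hN : ∀ i j, N i j ∈ Ideal.span {(3 : 𝓞 E)} := by
    intro i j
    rw [hNdef, Matrix.smul_apply, Ideal.mem_span_singleton]
    exact ⟨A i j, by rw [nsmul_eq_mul]; norm_num⟩
  have hN0 : N = 0 := eq_zero_of_one_add_pow_prime N hN hp hNp
  have h1 : h = 1 := by
    apply Units.ext
    rw [hmap, hN0, add_zero]
    change f.mapMatrix 1 = _
    rw [map_one, Units.val_one]
  rw [h1, orderOf_one] at hord
  exact hp.one_lt.ne hord

/-- The principal congruence subgroup of level `3` of a unitary group is torsion-free. -/
theorem principalCongruenceSubgroup_three_torsionFree {E : Type*} [Field E] [NumberField E]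
    (σ : E →+* E) (H : Matrix m m E) :
    ∀ γ ∈ principalCongruenceSubgroup σ H 3, IsOfFinOrder γ → γ = 1 :=
  fun γ hγ hfin => eq_one_of_isCongruentOneMod_three γ hγ.2.1 hfin

end Minkowski

/-- The principal congruence subgroup of level `3` is a congruence subgroup. -/
theorem isCongruenceSubgroup_principal_three {E : Type*} [Field E] [NumberField E]
    {m : Type*} [Fintype m] [DecidableEq m] (σ : E →+* E) (H : Matrix m m E) :
    IsCongruenceSubgroup σ H (principalCongruenceSubgroup σ H 3) := by
  refine ⟨fun g hg => hg.1, 3, by norm_num, le_rfl, ?_⟩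
  rw [Subgroup.subgroupOf_self]
  infer_instance

end HodgeCM.ToyG2

namespace HodgeCM

/-- `3 𝓞_L ≠ 0`. -/
theorem ToyG2.span_three_ne_zero (L : CMField) : (Ideal.span {((3 : ℕ) : 𝓞 L)} : Ideal (𝓞 L)) ≠ 0 := by
  rw [Ne, Ideal.zero_eq_bot, Ideal.span_singleton_eq_bot]; exact_mod_cast (by norm_num : (3 : ℕ) ≠ 0)

/-- The level-`3` principal congruence subgroup as a `Level V` (torsion-free by Minkowski), born as the PAIR
`(Γ(3), K_f(3 𝓞_L))` of `HodgeCM.CM.Basic` (`U(L⁺) ∩ K_f(3 𝓞_L) = Γ(3)`, vendored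
`UnitaryGroup.arithmeticLevel_finCongruenceLevel_span`; `K_f` compact open, vendored
`UnitaryGroup.isCompact_finCongruenceLevel` / `isOpen_finCongruenceLevel`). -/
noncomputable def Level.three {L : CMField} {ι₁ : L →+* ℂ} (V : HermSpace3 L ι₁) : Level V where
  Γ := Literature.AlgebraicGeometry.ShimuraVarieties.principalCongruenceSubgroup (conjRingHomK L) V.Hm 3
  K := Literature.NumberTheory.Automorphic.UnitaryGroup.finCongruenceLevel (↥(NumberField.maximalRealSubfield L))
    (L : Type) (NumberField.IsCMField.complexConj L) 3 V.Hm (Ideal.span {((3 : ℕ) : 𝓞 L)})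
  isCompact_K := Literature.NumberTheory.Automorphic.UnitaryGroup.isCompact_finCongruenceLevel
    (F := ↥(NumberField.maximalRealSubfield L)) (E := (L : Type)) (c := NumberField.IsCMField.complexConj L)
    (N := 3) (J := V.Hm) (ToyG2.span_three_ne_zero L)
  isOpen_K := Literature.NumberTheory.Automorphic.UnitaryGroup.isOpen_finCongruenceLevel
    (F := ↥(NumberField.maximalRealSubfield L)) (E := (L : Type)) (c := NumberField.IsCMField.complexConj L)
    (N := 3) (J := V.Hm) (ToyG2.span_three_ne_zero L)
  arithmeticLevel_K := by
    rw [Literature.NumberTheory.Automorphic.UnitaryGroup.arithmeticLevel_finCongruenceLevel_span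
      (by norm_num : (3 : ℕ) ≠ 0)]
    rfl
  torsionFree := ToyG2.principalCongruenceSubgroup_three_torsionFree _ _

/-- **Non-vacuity of `Level V`.** Every hermitian 3-space over a CM field carries a neat level;
in particular the binders `∃ Γ : Level V` / `∀ Γ : Level V` of the package are not vacuous. -/
theorem Level.nonempty {L : CMField} {ι₁ : L →+* ℂ} (V : HermSpace3 L ι₁) : Nonempty (Level V) :=
  ⟨Level.three V⟩

/-- (Ported verbatim from the HodgeCMPerL package; no docstring in the source.) -/
instance {L : CMField} {ι₁ : L →+* ℂ} (V : HermSpace3 L ι₁) : Nonempty (Level V) := Level.nonempty V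

end HodgeCM
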